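import Summits.ResolutionOfSingularities.ResolutionOfSingularities.Theses.HilbertSamuelElimination
import Summits.ResolutionOfSingularities.ResolutionOfSingularities.Theorems.HilbertSamuelEliminationSigmaMaxModificationsReduction
import Summits.ResolutionOfSingularities.ResolutionOfSingularities.Theorems.HilbertSamuelEliminationSigmaMaxModificationsLevelRaise
import Summits.ResolutionOfSingularities.ResolutionOfSingularities.Theorems.HilbertSamuelEliminationSigmaMaxModificationsNuToSigmaMax
import Mathlib.AlgebraicGeometry.Morphisms.Proper
import Mathlib.AlgebraicGeometry.Noetherian
import HarnessLib

/-!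
# `SigmaMaxModifications` (crux stmt-ResolutionOfSingularities-18506, route HilbertSamuelElimination)
— line `Sketch`, LEAD SKELETON, reshape 5 (lead gen 1 continuation c2, 2026-08-17):
LEVEL INDUCTION — the open cores at the binding level `N = dim X` only

**Crux.** For every prime `p`, field `k` of characteristic `p`, reduced separated finite-type
`X/k` which is not regular and every `N ≥ dim X` there is a `Σ^max`-modification of `X` at level
`N` (CJS, LNM 2270, Def. 6.15 in modification form: proper, reduced source of dimension `≤ N`,
an isomorphism over every open inside `X ∖ X_max` with dense preimage of `X ∖ X_max`, `H^N`
non-increasing, and (ME2) no maximal value of `Σ_X` survives). The inline `H^N` of the route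
file is `Scheme.hsFun` on the nose (`rfl`), `X_max = Scheme.hsMaxLocus X N`,
`Σ_X = Scheme.hsValues X N`. Write `B(X, N)` for the seven-clause `∃`-body.

**Reshape 5 (this file).** Reshape 4 (`Lines/Sketch.lean` of lead c1; reduction
`sigmaMaxModifications_iff_open_cores`, p160700) left the crux equivalent, modulo the two
printed theorems `CossartJannsenSaito2020_sigmaMaxElimination` (CJS Thm. 6.28 + 3.10 (1) +
Def. 6.14) and `CossartPiltant2019General` (CP 2019 Thm. 1.1), to two OPEN cores quantified over
EVERY level `N ≥ dim X` — and the level matters (`X_max(N+1) ⊊ X_max(N)` happens for reduced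
curves, refuter kit `Negative/Levels`). This reshape removes the level as a degree of freedom:
`SigmaMaxModifications_of` is a strong induction on `N` whose inputs are the crux bodies AT THE
BINDING LEVEL `N = dim X`:

* `stub_levelRaise` — PROVABLE (the dimension-free form of c1's `surface_succ`, p159874): if
  `B(Y, N)` holds for every reduced separated finite-type non-regular `Y/k` with `dim Y ≤ N`,
  then `B(X, N+1)` holds for every such `X` with `dim X ≤ N`. Proof: the open
  `U₁ = {x | ∃ μ, μ^{(1)} ∈ Σ^max_X(N+1), H^N_X(x) ≤ μ}` (open by the sharp upper
  semicontinuity at `N ≥ dim X`, `stub_isClosed_hsMaxLocus_over_field`, and the finiteness of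
  `Σ_X(N)`) contains `X_max(N+1)` and has `(U₁)_max(N) = U₁ ∩ X_max(N+1)`; `B(U₁, N)` read at
  level `N + 1` (`H^{N+1} = (H^N)^{(1)}`, CJS Rem. 2.29 (b)) is a local witness, glued with the
  identity of `X ∖ X_max(N+1)` by `sigmaMaxModification_of_localWitness` (p153270).
* base level `N = dim X`, graded by `N`: `N ≤ 1` — curves (`stub_curve` ∘ `stub_curveResolution`,
  landed p156715/p156708); `N = 2` — `sigmaMaxModifications_dim_le_two` (p148824) from the glued
  CJS fact `stub_cjsSigmaMaxElimination` (KNOWN IN PRINT); `N = 3` — isolated `X_max(3)`: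
  Cossart–Piltant resolution of a neighbourhood glued with the identity
  (`sigmaMaxModifications_dim_le_three_of_isolated`, p154168, fed by
  `stub_cossartPiltant2019General`, KNOWN IN PRINT; `X_max(3)` closed by the sharp
  semicontinuity p157713/p158563), corridor `X_max(3) ∩ closure (Sing X ∖ X_max(3)) ≠ ∅`:
  `stub_dim_three_corridor_base` (OPEN — CJS Rem. 6.29, CP2019 §1), now at the single level
  `N = 3`; `N ≥ 4` — `stub_dim_ge_four_base` (OPEN), now only for `dim X = N`.

So after this reshape the crux is closed MODULO exactly {CJS Thm. 6.28 (print), CP 2019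
Thm. 1.1 (print), `B(X, 3)` for corridor threefolds, `B(X, dim X)` for `dim X ≥ 4`} — the last
two being CJS Def. 6.15 / Cor. 6.18's hypothesis in the authors' own normalisation `N = dim X`.
-/

set_option linter.dupNamespace false -- mandated namespace of this single-conjunct summit

noncomputable section

open CategoryTheory AlgebraicGeometry TopologicalSpace
open Literature.AlgebraicGeometry.Resolution Literature.RingTheory.HilbertSamuel
open Summit.ResolutionOfSingularities.ResolutionOfSingularities.Theses.HilbertSamuelElimination

namespace Summit.ResolutionOfSingularities.ResolutionOfSingularities.Theorems.SigmaMaxModifications.Sketch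

/-! ## Stubs: the two printed theorems (named facts of the tree) -/

/-- **STUB (known in print, in the tree as a named fact): `Σ^max`-eliminations of reduced
excellent surfaces** — Cossart–Jannsen–Saito 2020, Def. 6.15 with Thm. 6.28 and Thm. 3.10 (1)
(the hypothesis of Cor. 6.18 for `d = 2`), the tree's named fact
`CossartJannsenSaito2020_sigmaMaxElimination` (`SurfaceResolutionSigmaMaxElimination.lean`):
for every reduced excellent Noetherian non-regular `X` of dimension `≤ 2` a blow-up sequence with
centres over `X_max(2)`, `H^2` non-increasing, killing the maximal values of `Σ_X(2)`.
[cite: CossartJannsenSaito2020, Def. 6.15, Thm. 6.28, Thm. 3.10 (1)] -/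
theorem stub_cjsSigmaMaxElimination : CossartJannsenSaito2020_sigmaMaxElimination.{0} := by
  sorry

/-- **STUB (known in print, in the tree as a named fact): Cossart–Piltant 2019, Thm. 1.1** —
every reduced separated quasi-excellent Noetherian scheme of dimension `≤ 3` has a resolution
which is an isomorphism over its regular locus (`CossartPiltant2019General`,
`QuasiExcellentSchemes.lean`). [cite: CossartPiltant2019, Thm. 1.1] -/
theorem stub_cossartPiltant2019General : CossartPiltant2019General.{0} := by
  sorry

/-! Literature-debt consolidation LANDED (wave 1, p163634, imported):
`stub_sigmaMaxElimination_of_nuElimination : CossartJannsenSaito2020_nuElimination → CossartJannsenSaito2020_sigmaMaxElimination`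
(CJS Def. 6.14 gluing over the finite set of maximal values; excellence of blow-ups proved in-file). -/

/-! ## Level raising `N → N + 1` on the class `dim ≤ N`: LANDED (wave 1, `stub_levelRaise`, p163333, imported) -/

/-! ## Stubs: the open cores, at the binding level `N = dim X` -/

/-- **STUB (OPEN): the corridor case in dimension `3`, at level `N = 3`.** For `X/k` reduced
separated of finite type, not regular, `dim X = 3`, whose Hilbert–Samuel locus `X_max(3)` MEETS
the closure of `Sing X ∖ X_max(3)`: a `Σ^max`-modification at level `3`. Over a corridor point
no modification that is an isomorphism off `X_max` can be regular, so resolution of threefolds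
(Cossart–Piltant) does not help; CJS's candidate (Rem. 6.29: permissible centres inside
`X_max`) is not known to terminate in dimension `3` (obstructions O1/O2; CP2019 Rem. 3.2).
[cite: CossartJannsenSaito2020, Rem. 6.29] [cite: CossartPiltant2019, §1] -/
theorem stub_dim_three_corridor_base :
    ∀ p : ℕ, p.Prime → ∀ (k : Type) [Field k] [CharP k p] (X : Scheme.{0})
      (f : X ⟶ Spec (.of k)), IsSeparated f → LocallyOfFiniteType f → QuasiCompact f →
      IsReduced X → ¬ Scheme.IsRegular X → ((3 : ℕ) : WithBot ℕ∞) ≤ topologicalKrullDim X →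
      topologicalKrullDim X ≤ ((3 : ℕ) : WithBot ℕ∞) →
      ¬ Disjoint (closure ((Scheme.regularLocus X)ᶜ \ Scheme.hsMaxLocus X 3))
          (Scheme.hsMaxLocus X 3) →
        ∃ (X' : Scheme.{0}) (π : X' ⟶ X), IsProper π ∧ IsReduced X' ∧
          topologicalKrullDim X' ≤ ((3 : ℕ) : WithBot ℕ∞) ∧
          (∀ U : X.Opens, (U : Set X) ⊆ (Scheme.hsMaxLocus X 3)ᶜ → IsIso (π ∣_ U)) ∧
          Dense ((fun x' => π.base x') ⁻¹' (Scheme.hsMaxLocus X 3)ᶜ) ∧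
          (∀ x' : X', Scheme.hsFun X' 3 x' ≤ Scheme.hsFun X 3 (π.base x')) ∧
          ∀ ν : ℕ → ℕ, Maximal (· ∈ Scheme.hsValues X 3) ν → ν ∉ Scheme.hsValues X' 3 := by
  sorry

/-- **STUB (OPEN): `Σ^max`-modifications from dimension `4` on, at level `N = dim X`.** For
every prime `p`, field `k` of characteristic `p`, reduced separated non-regular `X/k` of finite
type with `dim X = N ≥ 4`, a `Σ^max`-modification at level `N`. Nothing is known in print (no
resolution of singularities in positive characteristic from dimension `4`; CJS Rem. 6.29's
strategy is the authors' candidate). [cite: CossartJannsenSaito2020, Rem. 6.29] -/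
theorem stub_dim_ge_four_base :
    ∀ p : ℕ, p.Prime → ∀ (k : Type) [Field k] [CharP k p] (X : Scheme.{0})
      (f : X ⟶ Spec (.of k)), IsSeparated f → LocallyOfFiniteType f → QuasiCompact f →
      IsReduced X → ¬ Scheme.IsRegular X → ∀ N : ℕ, 4 ≤ N →
      (N : WithBot ℕ∞) ≤ topologicalKrullDim X → topologicalKrullDim X ≤ (N : WithBot ℕ∞) →
        ∃ (X' : Scheme.{0}) (π : X' ⟶ X), IsProper π ∧ IsReduced X' ∧
          topologicalKrullDim X' ≤ (N : WithBot ℕ∞) ∧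
          (∀ U : X.Opens, (U : Set X) ⊆ (Scheme.hsMaxLocus X N)ᶜ → IsIso (π ∣_ U)) ∧
          Dense ((fun x' => π.base x') ⁻¹' (Scheme.hsMaxLocus X N)ᶜ) ∧
          (∀ x' : X', Scheme.hsFun X' N x' ≤ Scheme.hsFun X N (π.base x')) ∧
          ∀ ν : ℕ → ℕ, Maximal (· ∈ Scheme.hsValues X N) ν → ν ∉ Scheme.hsValues X' N := by
  sorry

/-! ## Composition -/

/-- **The base level `N = dim X ≥ 2`** from the stubs: `N = 2` — the glued CJS fact
(`sigmaMaxModifications_dim_le_two`); `N = 3` — isolated (Cossart–Piltant,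
`sigmaMaxModifications_dim_le_three_of_isolated`, `X_max(3)` closed by the sharp
semicontinuity) or corridor (`stub_dim_three_corridor_base`); `N ≥ 4` —
`stub_dim_ge_four_base`. (`N ≤ 1` is `stub_curve`, which needs no lower bound.)
[cite: CossartJannsenSaito2020, Def. 6.15, Rem. 6.29] [cite: CossartPiltant2019, Thm. 1.1] -/
theorem body_baseLevel (p : ℕ) (hp : p.Prime) (k : Type) [Field k] [CharP k p] (X : Scheme.{0})
    (f : X ⟶ Spec (.of k)) (hsep : IsSeparated f) (hft : LocallyOfFiniteType f)
    (hqc : QuasiCompact f) (hred : IsReduced X) (hreg : ¬ Scheme.IsRegular X) (N : ℕ)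
    (hge : (N : WithBot ℕ∞) ≤ topologicalKrullDim X)
    (hle : topologicalKrullDim X ≤ (N : WithBot ℕ∞)) :
    ∃ (X' : Scheme.{0}) (π : X' ⟶ X), IsProper π ∧ IsReduced X' ∧
      topologicalKrullDim X' ≤ (N : WithBot ℕ∞) ∧
      (∀ U : X.Opens, (U : Set X) ⊆ (Scheme.hsMaxLocus X N)ᶜ → IsIso (π ∣_ U)) ∧
      Dense ((fun x' => π.base x') ⁻¹' (Scheme.hsMaxLocus X N)ᶜ) ∧
      (∀ x' : X', Scheme.hsFun X' N x' ≤ Scheme.hsFun X N (π.base x')) ∧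
      ∀ ν : ℕ → ℕ, Maximal (· ∈ Scheme.hsValues X N) ν → ν ∉ Scheme.hsValues X' N := by
  rcases Nat.lt_or_ge N 2 with h1 | h2
  · -- curves: `dim X ≤ N ≤ 1`
    exact stub_curve stub_curveResolution k X f hsep hft hqc hred hreg
      (hle.trans (by exact_mod_cast (by omega : N ≤ 1))) N hle
  rcases h2.eq_or_lt with h2 | h3
  · -- surfaces at level `2`: the glued CJS fact
    subst h2
    exact sigmaMaxModifications_dim_le_two stub_cjsSigmaMaxElimination k X f hft hqc hred hreg
      (by exact_mod_cast hle)
  rcases (show 3 ≤ N from h3).eq_or_lt with h3 | h4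
  · -- threefolds at level `3`: isolated (Cossart–Piltant) or corridor (open)
    subst h3
    by_cases hdisj : Disjoint (closure ((Scheme.regularLocus X)ᶜ \ Scheme.hsMaxLocus X 3))
        (Scheme.hsMaxLocus X 3)
    · have hcl : IsClosed (Scheme.hsMaxLocus X 3) :=
        (stub_isClosed_hsMaxLocus_over_field stub_hsFun_le_of_specializes_over_field k X f hft
          hqc 3 hle).2
      exact sigmaMaxModifications_dim_le_three_of_isolated stub_cossartPiltant2019General k X f
        hsep hft hqc hred hreg (by exact_mod_cast hle) 3 hle hcl hdisj
    · exact stub_dim_three_corridor_base p hp k X f hsep hft hqc hred hreg hge hle hdisj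
  · -- `dim X = N ≥ 4`: open
    exact stub_dim_ge_four_base p hp k X f hsep hft hqc hred hreg N h4 hge hle

/-- **All levels by induction on `N`**: at level `N + 1`, either `dim X ≤ N` and
`stub_levelRaise` applies to the induction hypothesis, or `dim X = N + 1` is the base level.
[cite: CossartJannsenSaito2020, Def. 6.15, Rem. 2.29 (b)] -/
theorem body_allLevels (p : ℕ) (hp : p.Prime) (k : Type) [Field k] [CharP k p] :
    ∀ (N : ℕ) (X : Scheme.{0}) (f : X ⟶ Spec (.of k)), IsSeparated f → LocallyOfFiniteType f →
      QuasiCompact f → IsReduced X → ¬ Scheme.IsRegular X →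
      topologicalKrullDim X ≤ (N : WithBot ℕ∞) →
        ∃ (X' : Scheme.{0}) (π : X' ⟶ X), IsProper π ∧ IsReduced X' ∧
          topologicalKrullDim X' ≤ (N : WithBot ℕ∞) ∧
          (∀ U : X.Opens, (U : Set X) ⊆ (Scheme.hsMaxLocus X N)ᶜ → IsIso (π ∣_ U)) ∧
          Dense ((fun x' => π.base x') ⁻¹' (Scheme.hsMaxLocus X N)ᶜ) ∧
          (∀ x' : X', Scheme.hsFun X' N x' ≤ Scheme.hsFun X N (π.base x')) ∧
          ∀ ν : ℕ → ℕ, Maximal (· ∈ Scheme.hsValues X N) ν → ν ∉ Scheme.hsValues X' N := by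
  intro N
  induction N with
  | zero =>
    intro X f hsep hft hqc hred hreg hdim
    exact stub_curve stub_curveResolution k X f hsep hft hqc hred hreg
      (hdim.trans (by exact_mod_cast (by omega : 0 ≤ 1))) 0 hdim
  | succ N ih =>
    intro X f hsep hft hqc hred hreg hdim
    rcases dim_le_or_succ_le (topologicalKrullDim X) N with h | h
    · exact stub_levelRaise k N ih X f hsep hft hqc hred hreg h
    · exact body_baseLevel p hp k X f hsep hft hqc hred hreg (N + 1) h hdim

/-- **The crux from the stubs**: `body_allLevels`; the inline `H^N` of the route decl is
`Scheme.hsFun` by `rfl`. [cite: CossartJannsenSaito2020, Def. 6.15, Rem. 6.13] -/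
theorem SigmaMaxModifications_of : SigmaMaxModifications := by
  intro p hp k _ _ X f hsep hft hqc hred hreg N hdim
  exact body_allLevels p hp k N X f hsep hft hqc hred hreg hdim

end Summit.ResolutionOfSingularities.ResolutionOfSingularities.Theorems.SigmaMaxModifications.Sketch

end
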